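import Summits.Ventures.DiscreteObjects.PP12.SingerDifferenceSet
import Summits.Ventures.DiscreteObjects.PP12.PrimeOrderAtlas
import Literature.Combinatorics.Designs.ProjectivePlaneOrder12Collineations

/-!
# PP(12): no collineation of order 157 — the cyclic (Singer) case of the prime-order atlas, in the kernel
Framing: lottery ticket; floor = certified bounds/negative ranges.

**Theorem (`no_collineation_order_157`).** A projective plane of order 12 (Mathlib `Configuration.ProjectivePlane`,
157 points) admits no collineation `σ ≠ 1` with `σ ^ 157 = 1` on points. Hence (`prime_mem_of_collineation_order12`)
the prime orders of collineations of a projective plane of order 12 lie in `{2, 3, 5, 11, 13}` — the kernel atlas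
`prime_order_atlas_order12` loses its `p = 157` entry (`p = 7`: `NoOrderSeven`; `p > 13`: `PrimeList`); and, at group
level (`not_dvd_card_collineationGroup_157`, Literature `IsCollineationGroup`), no collineation group of a projective
plane of order 12 has order divisible by `157` — in particular no Singer group: there is no cyclic (equivalently, since
`157` is prime, no abelian point-regular) projective plane of order 12, census family B2.

In print all primes `p ≥ 5` are excluded (Janko–van Trung, Geom. Dedicata 12 (1982) 101–110: the full collineation
group is a `{2,3}`-group); the case `p = 157 = v` is classical: such a `σ` is fixed-point-free
(`fixedCard_eq_zero_of_pow_157`), so `⟨σ⟩` is regular on points and lines and the plane is CYCLIC, i.e. carries a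
planar `(157, 13, 1)` difference set (Singer; `SingerDifferenceSet.lean`), and there is none: by **Hall's multiplier
theorem** (1947; Literature `DifferenceSetMultiplier`, Lander 1983 Thm. 5.3) the primes `2, 3 ∣ 12 = n` are
multipliers, they fix the translate with element-sum `0` (Lander Thm. 5.10), hence so does `6`, a primitive root
modulo `157` (`orderOf_six_zmod157`), whose orbit of a non-zero element of that translate has `156 > 13` elements
(`no_planar_differenceSet_157`). This was the census control B2 of cell `pub-namedobj` (target M; two engines +
lead third check, 2026-08-20); it is now a kernel theorem. Value: kernel replication of print, no novelty claim.
Everything is proved; no `sorry`, no new axioms; zero compute.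
-/

namespace Summit.Ventures.DiscreteObjects.PP12

open Configuration Finset
open Literature.Combinatorics.Designs.DifferenceSets

namespace Collineation

section Arithmetic

/-- powers of `6` modulo `157`, evaluated in `ℕ` -/
theorem six_pow_zmod157_ne_one {e : ℕ} (h : 6 ^ e % 157 ≠ 1) : (6 : ZMod 157) ^ e ≠ 1 := by
  intro h1
  apply h
  have : ((6 ^ e : ℕ) : ZMod 157) = ((1 : ℕ) : ZMod 157) := by push_cast; exact h1
  rw [ZMod.natCast_eq_natCast_iff'] at this
  exact this

/-- `6` is a primitive root modulo `157`. -/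
theorem orderOf_six_zmod157 : orderOf (6 : ZMod 157) = 156 := by
  refine orderOf_eq_of_pow_and_pow_div_prime (by norm_num) ?_ ?_
  · have h : ((6 ^ 156 : ℕ) : ZMod 157) = ((1 : ℕ) : ZMod 157) := by
      rw [ZMod.natCast_eq_natCast_iff']; decide
    rw [Nat.cast_pow, Nat.cast_ofNat, Nat.cast_one] at h
    exact h
  · intro q hq hqd
    have h156 : (156 : ℕ) = 2 ^ 2 * (3 * 13) := by norm_num
    have hq' : q ∣ 2 ^ 2 * (3 * 13) := h156 ▸ hqd
    rcases (Nat.Prime.dvd_mul hq).mp hq' with h | h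
    · have := (Nat.prime_dvd_prime_iff_eq hq Nat.prime_two).mp (hq.dvd_of_dvd_pow h)
      subst this
      exact six_pow_zmod157_ne_one (by decide)
    · rcases (Nat.Prime.dvd_mul hq).mp h with h | h
      · have := (Nat.prime_dvd_prime_iff_eq hq Nat.prime_three).mp h
        subst this
        exact six_pow_zmod157_ne_one (by decide)
      · have := (Nat.prime_dvd_prime_iff_eq hq (by norm_num : Nat.Prime 13)).mp h
        subst this
        exact six_pow_zmod157_ne_one (by decide)

/-- **No planar difference set of order 12 in `ℤ/157`** (Hall 1947, via the multipliers `2` and `3`): there is no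
`(157, 13, 1)` difference set in `ZMod 157`. -/
theorem no_planar_differenceSet_157 (D : Finset (ZMod 157)) (hD : IsDifferenceSet D 1) (hcard : D.card = 13) :
    False := by
  classical
  haveI : Fact (Nat.Prime 157) := ⟨by norm_num⟩
  have hcardG : Fintype.card (ZMod 157) = 157 := ZMod.card 157
  -- the translate with element-sum zero
  have hcop : (D.card).Coprime (Fintype.card (ZMod 157)) := by rw [hcard, hcardG]; norm_num
  obtain ⟨g, hg⟩ := IsDifferenceSet.exists_translate_sum_eq_zero D hcop
  set D' := D.image fun x => x + g with hD'def
  have hD' : IsDifferenceSet D' 1 := hD.image_add_right g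
  have hcard' : D'.card = 13 := by rw [hD'def, Finset.card_image_of_injective _ (add_left_injective g), hcard]
  have hcop' : (D'.card).Coprime (Fintype.card (ZMod 157)) := by rw [hcard', hcardG]; norm_num
  -- multipliers 2 and 3 fix D'
  have hfix : ∀ t : ℕ, t.Prime → t ∣ 12 → D'.image (fun x => t • x) = D' := by
    intro t ht ht12
    have ht0 : (t : ZMod 157) ≠ 0 := by
      rw [Ne, ZMod.natCast_eq_zero_iff]
      intro h
      have h1 := Nat.le_of_dvd (by norm_num) ht12
      have h2 := Nat.le_of_dvd ht.pos h
      omega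
    have hinj : Function.Injective fun x : ZMod 157 => t • x := by
      intro a b hab
      simp only [nsmul_eq_mul] at hab
      exact mul_left_cancel₀ ht0 hab
    have hlam : 1 < t := ht.one_lt
    have hn : 1 < D'.card := by rw [hcard']; norm_num
    have hpn : t ∣ D'.card - 1 := by rw [hcard']; exact ht12
    have hpv : ¬ t ∣ Fintype.card (ZMod 157) := by
      rw [hcardG]
      intro h
      have := (Nat.prime_dvd_prime_iff_eq ht (by norm_num : Nat.Prime 157)).mp h
      subst this
      have : (157 : ℕ) ∣ 12 := ht12
      omega
    obtain ⟨s, hs⟩ := hD'.multiplier ht hlam hn hpn hpv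
    exact IsDifferenceSet.image_nsmul_eq_self_of_sum_eq_zero D' hcop' hg hinj hs
  have h2 := hfix 2 Nat.prime_two (by norm_num)
  have h3 := hfix 3 Nat.prime_three (by norm_num)
  have hmul : ∀ x ∈ D', (6 : ZMod 157) * x ∈ D' := by
    intro x hx
    have h3x : (3 : ZMod 157) * x ∈ D' := by
      rw [← h3]; exact mem_image.mpr ⟨x, hx, by simp [nsmul_eq_mul]⟩
    have h6x : (2 : ZMod 157) * ((3 : ZMod 157) * x) ∈ D' := by
      rw [← h2]; exact mem_image.mpr ⟨_, h3x, by simp [nsmul_eq_mul]⟩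
    have : (6 : ZMod 157) * x = 2 * (3 * x) := by ring
    rw [this]; exact h6x
  have hpow : ∀ n : ℕ, ∀ x ∈ D', (6 : ZMod 157) ^ n * x ∈ D' := by
    intro n
    induction n with
    | zero => intro x hx; simpa using hx
    | succ n ih => intro x hx; rw [pow_succ', mul_assoc]; exact hmul _ (ih x hx)
  -- a non-zero element of D'
  obtain ⟨x, hx, hx0⟩ : ∃ x ∈ D', x ≠ 0 := by
    obtain ⟨a, ha, b, hb, hab⟩ := Finset.one_lt_card.mp (by rw [hcard']; norm_num : 1 < D'.card)
    by_cases ha0 : a = 0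
    · exact ⟨b, hb, fun hb0 => hab (ha0.trans hb0.symm)⟩
    · exact ⟨a, ha, ha0⟩
  -- its orbit under the primitive root 6 has 156 elements, all in D'
  have hsub : (Finset.range 156).image (fun n => (6 : ZMod 157) ^ n * x) ⊆ D' := by
    intro y hy
    obtain ⟨n, -, rfl⟩ := mem_image.mp hy
    exact hpow n x hx
  have hinjOn : Set.InjOn (fun n => (6 : ZMod 157) ^ n * x) (Finset.range 156 : Set ℕ) := by
    intro a ha b hb hab
    have hab' : (6 : ZMod 157) ^ a = 6 ^ b := mul_right_cancel₀ hx0 hab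
    have ha' : a ∈ Set.Iio (orderOf (6 : ZMod 157)) := by
      rw [orderOf_six_zmod157]; simpa using ha
    have hb' : b ∈ Set.Iio (orderOf (6 : ZMod 157)) := by
      rw [orderOf_six_zmod157]; simpa using hb
    exact pow_injOn_Iio_orderOf ha' hb' hab'
  have h156 : ((Finset.range 156).image fun n => (6 : ZMod 157) ^ n * x).card = 156 := by
    rw [Finset.card_image_of_injOn hinjOn, Finset.card_range]
  have := Finset.card_le_card hsub
  rw [h156, hcard'] at this
  omega

end Arithmetic

section PlaneOrder12

variable {P L : Type*} [Membership P L] [ProjectivePlane P L] [Fintype P] [Fintype L]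
  [DecidableEq P] [DecidableEq L] (σ : Collineation P L)

/-- **A projective plane of order 12 has no collineation of order 157** (kernel). In print: Janko–van Trung
1982 (`p ∤ |Aut|` for `p ≥ 5`); classically the fixed-point-free case is a cyclic plane, i.e. a planar
`(157,13,1)` difference set, excluded by Hall's multiplier theorem (1947) — which is the route formalised here
(census control B2 of cell pub-namedobj, now in the kernel). -/
theorem no_collineation_order_157 (h12 : ProjectivePlane.order P L = 12) (hne : σ.onPoints ≠ 1)
    (hq : σ.onPoints ^ 157 = 1) : False := by
  classical
  haveI : Fact (Nat.Prime 157) := ⟨by norm_num⟩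
  have hv : Fintype.card P = 157 := by rw [ProjectivePlane.card_points P L, h12]; norm_num
  -- the order of σ on points is exactly 157
  have hord : orderOf σ.onPoints = 157 := orderOf_eq_prime hq hne
  -- every non-trivial power is again fixed-point-free of order 157 (on points and on lines)
  have hpow : ∀ m : ℕ, 0 < m → m < 157 →
      (∀ x : P, (σ.onPoints ^ m) x ≠ x) ∧ (∀ l : L, (σ.onLines ^ m) l ≠ l) := by
    intro m hm0 hm
    -- the m-th power as a collineation
    let τ : Collineation P L := ⟨σ.onPoints ^ m, σ.onLines ^ m, fun p l => σ.pow_mem_iff m p l⟩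
    have hne' : τ.onPoints ≠ 1 := by
      intro h
      have := orderOf_dvd_of_pow_eq_one (show σ.onPoints ^ m = 1 from h)
      rw [hord] at this
      exact absurd (Nat.le_of_dvd hm0 this) (not_le.mpr hm)
    have hq' : τ.onPoints ^ 157 = 1 := by
      show (σ.onPoints ^ m) ^ 157 = 1
      rw [← pow_mul, mul_comm, pow_mul, hq, one_pow]
    have hP := τ.fixedCard_eq_zero_of_pow_157 h12 hne' hq'
    have hL : fixedCard τ.onLines = 0 := by rw [← τ.fixedCard_points_eq_lines]; exact hP
    exact ⟨ne_of_fixedCard_eq_zero hP, ne_of_fixedCard_eq_zero hL⟩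
  have hσL : σ.onLines ^ 157 = 1 := σ.onLines_pow_eq_one hq
  obtain ⟨D, hD, hcard⟩ := σ.exists_differenceSet_of_regular 157 hv hq hσL
    (fun m hm0 hm => (hpow m hm0 hm).1) (fun m hm0 hm => (hpow m hm0 hm).2)
  rw [h12] at hcard
  exact no_planar_differenceSet_157 D hD hcard

/-- Corollary: the prime orders of collineations of a projective plane of order 12 lie in `{2, 3, 5, 11, 13}`
(kernel; `7` by `NoOrderSeven`, `157` by `no_collineation_order_157`, the rest by `PrimeList`). -/
theorem prime_mem_of_collineation_order12 (h12 : ProjectivePlane.order P L = 12) (hne : σ.onPoints ≠ 1)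
    {p : ℕ} (hp : p.Prime) (hq : σ.onPoints ^ p = 1) : p = 2 ∨ p = 3 ∨ p = 5 ∨ p = 11 ∨ p = 13 := by
  rcases σ.prime_of_collineation_order12 h12 hne hp hq with h | h | h | h | h | h
  · exact Or.inl h
  · exact Or.inr (Or.inl h)
  · exact Or.inr (Or.inr (Or.inl h))
  · exact Or.inr (Or.inr (Or.inr (Or.inl h)))
  · exact Or.inr (Or.inr (Or.inr (Or.inr h)))
  · subst h; exact (σ.no_collineation_order_157 h12 hne hq).elim

/-- **Group form (census family B2, 'Singer type').** No collineation group of a projective plane of order 12 (a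
finite group acting on points and lines, faithfully on points, preserving incidence — Literature
`IsCollineationGroup`) has order divisible by `157`; in particular no group acts regularly (as a Singer cycle) on
the `157` points, i.e. there is no cyclic (or abelian) projective plane of order 12. -/
theorem not_dvd_card_collineationGroup_157 (h12 : ProjectivePlane.order P L = 12)
    (G : Type*) [Group G] [Fintype G] [MulAction G P] [MulAction G L]
    (hG : Literature.Combinatorics.Designs.IsCollineationGroup G P L) : ¬ 157 ∣ Fintype.card G := by
  classical
  intro hdvd
  haveI : Fact (Nat.Prime 157) := ⟨by norm_num⟩
  obtain ⟨g, hg⟩ := exists_prime_orderOf_dvd_card 157 hdvd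
  haveI := hG.1
  -- g acts as a collineation of order 157
  let τ : Collineation P L :=
    ⟨MulAction.toPerm g, MulAction.toPerm g, fun p l => (hG.2 g p l).symm⟩
  have hq : τ.onPoints ^ 157 = 1 := by
    show (MulAction.toPermHom G P g) ^ 157 = 1
    rw [← map_pow, ← hg, pow_orderOf_eq_one, map_one]
  have hne : τ.onPoints ≠ 1 := by
    intro h
    have h1 : MulAction.toPermHom G P g = MulAction.toPermHom G P 1 := by rw [map_one]; exact h
    have hg1 : g = 1 := MulAction.toPerm_injective h1
    rw [hg1, orderOf_one] at hg
    norm_num at hg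
  exact τ.no_collineation_order_157 h12 hne hq

end PlaneOrder12

end Collineation

end Summit.Ventures.DiscreteObjects.PP12
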